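import Summits.CriticalPhenomena.PercolationContinuityZ3.Theorems.PercNearOneGluingNoHeavyLowerTailAPLTwoSidedComposition
import Summits.CriticalPhenomena.PercolationContinuityZ3.Theorems.PercNearOneGluingNoHeavyLowerTailAPLShortcutParallel
import Summits.CriticalPhenomena.PercolationContinuityZ3.Theorems.PercNearOneGluingNoHeavyLowerTailAPLBeadChain
import Summits.CriticalPhenomena.PercolationContinuityZ3.Theorems.PercNearOneGluingNoHeavyLowerTailGZSP
import Summits.CriticalPhenomena.PercolationContinuityZ3.Theorems.PercNearOneGluingNoHeavyLowerTailAPLLadderCells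
import HarnessLib

/-!
# `NoHeavyLowerTail` (stmt-CriticalPhenomena-4575) — THE SERIES–PARALLEL THEOREM: `E = κ²/(pπ·m) ≤ 28/27` for the apex over every
# two-terminal series–parallel network (apex edges anywhere, arbitrary weights)

Support file (prover prim-ineq-gen-8 gens 60–61; `--supports stmt-CriticalPhenomena-4575`; memos FINDING-gen60-TWOSIDED.md §6,
FINDING-gen61-SPTHEOREM.md in run/shared/lean/prim/prim-ineq-gen-8/).  No definitions, no named facts, no sorries.
Setting of `shortcut_parallel` / `series_reduction`: weights `p ∈ [0,1]` on `Sym2 V`, `DecisionTree.PrW`, clusters `Gladkov.cl`, apex `o`, ports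
`u, v`, `E = κ²/(pπm)` with `p = P(u ∈ cl o)`, `π = P(v ∈ cl o)`, `τ = P(both)`, `κ = τ − pπ`, `m = P(u ∉ cl o, v ∈ cl u)`; everything division-free.
§1 (gen 60): `conn_comm_eq`, `both_comm_eq` (bookkeeping; `P(v ∈ cl u) = m + τ` is `pendant_split_bc'`), `comp_le_of_apex_joined` (degenerate case) and **`parallel_comp_le`**:
PARALLEL COMPOSITION at `o, u, v` of two apex-carrying networks preserves `E ≤ 28/27` (`PrW` form of U(28/27) = `twoSided_comp_le`).
§2 (gen 61): `E_swap`, `portIsolated_left_E` / `portIsolated_right_E`, and **`sp_E_le`** — THE SERIES–PARALLEL THEOREM: for every two-terminal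
series–parallel apex network `GZSP.IsSPNet o E u v` (reviewed syntax of `…LowerTailGZSPDefs`: the `u–v` graph avoiding `o` is ANY two-terminal
series–parallel graph, `o` joined to ANY set of its vertices) and all weights in `[0,1]`:
`(P(u,v ∈ cl o) − P(u ∈ cl o)P(v ∈ cl o))² ≤ (28/27)·P(u ∈ cl o)·P(v ∈ cl o)·P(u ∉ cl o, v ∈ cl u)` (induction over the syntax: `apexFree_E`,
`parallel_comp_le`, `series_reduction`); **`sp_E_le_prodBernoulli`** — the same for `prodBernoulli w`.  The constant is optimal (balanced apex
ladders, `…APLLadderSharpness`); bead chains have `E ≤ 1` (`beadChain_E_le_one`); general graphs reach `1.1158` (memo gen 56). [this work]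
-/

namespace Summit.CriticalPhenomena.PercolationContinuityZ3.Theorems

namespace APL

open Literature.Probability.Percolation Literature.Probability.Percolation.Gladkov Literature.Probability.Percolation.DecisionTree
open scoped Classical

variable {V : Type*} [Fintype V]

/-! ### §1 Parallel composition of two apex-carrying networks (`PrW` form of `twoSided_comp_le`) -/

section Parallel

variable [DecidableEq V]

/-- `P(o ∈ cl u) = P(u ∈ cl o)` (symmetry of clusters). [folklore] -/
theorem conn_comm_eq (p : Sym2 V → ℝ) (D : Finset (Sym2 V)) (o u : V) :
    PrW D p {K : Finset (Sym2 V) | o ∈ cl K u} = PrW D p {K : Finset (Sym2 V) | u ∈ cl K o} :=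
  PrW_congr_set D p fun K _ => by simp only [Set.mem_setOf_eq]; exact mem_cl_comm

/-- `P(o ∈ cl u, v ∈ cl u) = P(u ∈ cl o, v ∈ cl o)` (`= τ`). [folklore] -/
theorem both_comm_eq (p : Sym2 V → ℝ) (D : Finset (Sym2 V)) (o u v : V) :
    PrW D p {K : Finset (Sym2 V) | o ∈ cl K u ∧ v ∈ cl K u} = PrW D p {K : Finset (Sym2 V) | u ∈ cl K o ∧ v ∈ cl K o} := by
  refine PrW_congr_set D p fun K _ => ?_
  simp only [Set.mem_setOf_eq]
  constructor
  · rintro ⟨hou, hvu⟩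
    exact ⟨mem_cl_comm.1 hou, ThreePointLB.mem_cl_trans (mem_cl_comm.1 hou) hvu⟩
  · rintro ⟨huo, hvo⟩
    exact ⟨mem_cl_comm.1 huo, ThreePointLB.mem_cl_trans (mem_cl_comm.1 huo) hvo⟩

/-- Degenerate case of the composition theorem: if in one factor the apex is never isolated (`x₀ + m = 0` or `y₀ + m′ = 0`) then the
composite has `z_m = 0` and `κ_z = 0` (by `comp_harris`), so `E ≤ C` holds trivially. [this work] -/
theorem comp_le_of_apex_joined (x0 B A m τ y0 B' A' m' τ' zB zA zm zτ : ℝ)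
    (h0 : 0 ≤ x0) (hB : 0 ≤ B) (hA : 0 ≤ A) (hm : 0 ≤ m) (hτ : 0 ≤ τ) (hsum : x0 + B + A + m + τ = 1)
    (h0' : 0 ≤ y0) (hB' : 0 ≤ B') (hA' : 0 ≤ A') (hm' : 0 ≤ m') (hτ' : 0 ≤ τ') (hsum' : y0 + B' + A' + m' + τ' = 1)
    (hO : x0 + m = 0 ∨ y0 + m' = 0)
    (hH : (τ + B) * (τ + A) ≤ τ) (hH' : (τ' + B') * (τ' + A') ≤ τ')
    (hzB : zB = x0 * B' + B * y0 + B * B') (hzA : zA = x0 * A' + A * y0 + A * A') (hzm : zm = x0 * m' + m * y0 + m * m')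
    (hzτ : zτ = τ * (y0 + B' + A' + m' + τ') + (x0 + B + A + m) * τ' + B * (A' + m') + A * (B' + m') + m * (B' + A')) :
    (zτ - (zτ + zB) * (zτ + zA)) ^ 2 ≤ 28 / 27 * ((zτ + zB) * (zτ + zA)) * zm := by
  have hx0 : x0 = 1 - B - A - m - τ := by linarith
  have hy0 : y0 = 1 - B' - A' - m' - τ' := by linarith
  have hκ := comp_harris x0 B A m τ y0 B' A' m' τ' h0 hB hA hm hτ h0' hB' hA' hm' hτ'
    (by have e : (x0 + m) * τ - A * B = τ - (τ + B) * (τ + A) := by rw [hx0]; ring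
        rw [e]; linarith [hH])
    (by have e : (y0 + m') * τ' - A' * B' = τ' - (τ' + B') * (τ' + A') := by rw [hy0]; ring
        rw [e]; linarith [hH'])
  rw [← hzτ, ← hzA, ← hzB, ← hzm] at hκ
  have eκ : zτ - (zτ + zB) * (zτ + zA) = (x0 * y0 + zm) * zτ - zA * zB := by
    rw [hzτ, hzB, hzA, hzm, hx0, hy0]; ring
  have hzA0 : 0 ≤ zA := by rw [hzA]; positivity
  have hzB0 : 0 ≤ zB := by rw [hzB]; positivity
  have hzm0 : zm = 0 := by
    rcases hO with h | h
    · have hx00 : x0 = 0 := by linarith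
      have hm0 : m = 0 := by linarith
      rw [hzm, hx00, hm0]; ring
    · have hy00 : y0 = 0 := by linarith
      have hm0 : m' = 0 := by linarith
      rw [hzm, hy00, hm0]; ring
  have hx0y0 : x0 * y0 = 0 := by
    rcases hO with h | h
    · have hx00 : x0 = 0 := by linarith
      rw [hx00]; ring
    · have hy00 : y0 = 0 := by linarith
      rw [hy00]; ring
  rw [hzm0, hx0y0] at hκ
  have hprod : zA * zB = 0 := le_antisymm (by linarith) (mul_nonneg hzA0 hzB0)
  have hκ0 : zτ - (zτ + zB) * (zτ + zA) = 0 := by rw [eκ, hzm0, hx0y0, hprod]; ring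
  rw [hκ0, hzm0]; simp

/-- **PARALLEL COMPOSITION PRESERVES `E ≤ 28/27`.**  Let `D₁, D₂` be disjoint edge sets such that every vertex meeting both is one of
`o, u, v` (weights `p ∈ [0,1]`).  If `(o; u, v)` satisfies `E ≤ 28/27` on `D₁` and on `D₂`, i.e.
`(P(u,v ∈ cl o) − P(u ∈ cl o)P(v ∈ cl o))² ≤ (28/27)·P(u ∈ cl o)·P(v ∈ cl o)·P(u ∉ cl o, v ∈ cl u)` for each, then the same holds on
`D₁ ∪ D₂`.  (Cells of the union = composite cells by `glued_cell_*`; Harris at `o, u, v` by `PrW_harris_cl`; then `twoSided_comp_le`,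
or `comp_harris` when an apex is never isolated.)  Sharp: `28/27` cannot be lowered (`shortcut_first_order_sharp`). [this work] -/
theorem parallel_comp_le (p : Sym2 V → ℝ) (hp0 : ∀ e, 0 ≤ p e) (hp1 : ∀ e, p e ≤ 1)
    (D₁ D₂ : Finset (Sym2 V)) (hdisj : Disjoint D₁ D₂) (o u v : V)
    (hsep : ∀ x : V, (∃ e ∈ D₁, x ∈ e) → (∃ e ∈ D₂, x ∈ e) → (x = o ∨ x = u ∨ x = v))
    (hE₁ : (PrW D₁ p {K : Finset (Sym2 V) | u ∈ cl K o ∧ v ∈ cl K o}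
        - PrW D₁ p {K : Finset (Sym2 V) | u ∈ cl K o} * PrW D₁ p {K : Finset (Sym2 V) | v ∈ cl K o}) ^ 2
        ≤ 28 / 27 * PrW D₁ p {K : Finset (Sym2 V) | u ∈ cl K o} * PrW D₁ p {K : Finset (Sym2 V) | v ∈ cl K o}
          * PrW D₁ p {K : Finset (Sym2 V) | u ∉ cl K o ∧ v ∈ cl K u})
    (hE₂ : (PrW D₂ p {K : Finset (Sym2 V) | u ∈ cl K o ∧ v ∈ cl K o}
        - PrW D₂ p {K : Finset (Sym2 V) | u ∈ cl K o} * PrW D₂ p {K : Finset (Sym2 V) | v ∈ cl K o}) ^ 2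
        ≤ 28 / 27 * PrW D₂ p {K : Finset (Sym2 V) | u ∈ cl K o} * PrW D₂ p {K : Finset (Sym2 V) | v ∈ cl K o}
          * PrW D₂ p {K : Finset (Sym2 V) | u ∉ cl K o ∧ v ∈ cl K u}) :
    (PrW (D₁ ∪ D₂) p {K : Finset (Sym2 V) | u ∈ cl K o ∧ v ∈ cl K o}
        - PrW (D₁ ∪ D₂) p {K : Finset (Sym2 V) | u ∈ cl K o} * PrW (D₁ ∪ D₂) p {K : Finset (Sym2 V) | v ∈ cl K o}) ^ 2
      ≤ 28 / 27 * PrW (D₁ ∪ D₂) p {K : Finset (Sym2 V) | u ∈ cl K o} * PrW (D₁ ∪ D₂) p {K : Finset (Sym2 V) | v ∈ cl K o}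
        * PrW (D₁ ∪ D₂) p {K : Finset (Sym2 V) | u ∉ cl K o ∧ v ∈ cl K u} := by
  -- Harris at o, u, v for both pieces
  have hH₁ := PrW_harris_cl D₁ hp0 hp1 o u v
  have hU₁ := PrW_harris_cl D₁ hp0 hp1 u o v
  have hV₁ := PrW_harris_cl D₁ hp0 hp1 v o u
  have hH₂ := PrW_harris_cl D₂ hp0 hp1 o u v
  have hU₂ := PrW_harris_cl D₂ hp0 hp1 u o v
  have hV₂ := PrW_harris_cl D₂ hp0 hp1 v o u
  rw [conn_comm_eq p D₁ o u, pendant_split_bc' p D₁ o u v, both_comm_eq p D₁ o u v] at hU₁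
  rw [conn_comm_eq p D₁ o v, conn_comm_eq p D₁ u v, pendant_split_bc' p D₁ o u v, both_comm_eq p D₁ o v u] at hV₁
  rw [conn_comm_eq p D₂ o u, pendant_split_bc' p D₂ o u v, both_comm_eq p D₂ o u v] at hU₂
  rw [conn_comm_eq p D₂ o v, conn_comm_eq p D₂ u v, pendant_split_bc' p D₂ o u v, both_comm_eq p D₂ o v u] at hV₂
  have hsw₁ : PrW D₁ p {K : Finset (Sym2 V) | v ∈ cl K o ∧ u ∈ cl K o} = PrW D₁ p {K : Finset (Sym2 V) | u ∈ cl K o ∧ v ∈ cl K o} :=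
    PrW_congr_set D₁ p fun K _ => by simp only [Set.mem_setOf_eq]; exact And.comm
  have hsw₂ : PrW D₂ p {K : Finset (Sym2 V) | v ∈ cl K o ∧ u ∈ cl K o} = PrW D₂ p {K : Finset (Sym2 V) | u ∈ cl K o ∧ v ∈ cl K o} :=
    PrW_congr_set D₂ p fun K _ => by simp only [Set.mem_setOf_eq]; exact And.comm
  rw [hsw₁] at hV₁; rw [hsw₂] at hV₂
  -- everything in cells
  rw [conn_eq_cells_b p D₁ o u v, conn_eq_cells_c p D₁ o u v, m_event_eq_cell p D₁ o u v] at hE₁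
  rw [conn_eq_cells_b p D₂ o u v, conn_eq_cells_c p D₂ o u v, m_event_eq_cell p D₂ o u v] at hE₂
  rw [conn_eq_cells_b p D₁ o u v, conn_eq_cells_c p D₁ o u v] at hH₁
  rw [conn_eq_cells_b p D₂ o u v, conn_eq_cells_c p D₂ o u v] at hH₂
  rw [conn_eq_cells_b p D₁ o u v] at hU₁
  rw [conn_eq_cells_c p D₁ o u v] at hV₁
  rw [conn_eq_cells_b p D₂ o u v] at hU₂
  rw [conn_eq_cells_c p D₂ o u v] at hV₂
  rw [conn_eq_cells_b p (D₁ ∪ D₂) o u v, conn_eq_cells_c p (D₁ ∪ D₂) o u v, m_event_eq_cell p (D₁ ∪ D₂) o u v,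
    glued_cell_ab p D₁ D₂ hdisj o u v hsep, glued_cell_ac p D₁ D₂ hdisj o u v hsep, glued_cell_bc p D₁ D₂ hdisj o u v hsep,
    glued_cell_three p D₁ D₂ hdisj o u v hsep]
  set Z1 := PrW D₁ p {K : Finset (Sym2 V) | u ∉ cl K o ∧ v ∉ cl K o ∧ v ∉ cl K u} with hZ1
  set B1 := PrW D₁ p {K : Finset (Sym2 V) | u ∈ cl K o ∧ v ∉ cl K o} with hB1
  set A1 := PrW D₁ p {K : Finset (Sym2 V) | v ∈ cl K o ∧ u ∉ cl K o} with hA1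
  set M1 := PrW D₁ p {K : Finset (Sym2 V) | u ∉ cl K o ∧ v ∉ cl K o ∧ v ∈ cl K u} with hM1
  set T1 := PrW D₁ p {K : Finset (Sym2 V) | u ∈ cl K o ∧ v ∈ cl K o} with hT1
  set Z2 := PrW D₂ p {K : Finset (Sym2 V) | u ∉ cl K o ∧ v ∉ cl K o ∧ v ∉ cl K u} with hZ2
  set B2 := PrW D₂ p {K : Finset (Sym2 V) | u ∈ cl K o ∧ v ∉ cl K o} with hB2
  set A2 := PrW D₂ p {K : Finset (Sym2 V) | v ∈ cl K o ∧ u ∉ cl K o} with hA2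
  set M2 := PrW D₂ p {K : Finset (Sym2 V) | u ∉ cl K o ∧ v ∉ cl K o ∧ v ∈ cl K u} with hM2
  set T2 := PrW D₂ p {K : Finset (Sym2 V) | u ∈ cl K o ∧ v ∈ cl K o} with hT2
  have hZ1n : 0 ≤ Z1 := PrW_nonneg D₁ hp0 hp1 _
  have hB1n : 0 ≤ B1 := PrW_nonneg D₁ hp0 hp1 _
  have hA1n : 0 ≤ A1 := PrW_nonneg D₁ hp0 hp1 _
  have hM1n : 0 ≤ M1 := PrW_nonneg D₁ hp0 hp1 _
  have hT1n : 0 ≤ T1 := PrW_nonneg D₁ hp0 hp1 _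
  have hZ2n : 0 ≤ Z2 := PrW_nonneg D₂ hp0 hp1 _
  have hB2n : 0 ≤ B2 := PrW_nonneg D₂ hp0 hp1 _
  have hA2n : 0 ≤ A2 := PrW_nonneg D₂ hp0 hp1 _
  have hM2n : 0 ≤ M2 := PrW_nonneg D₂ hp0 hp1 _
  have hT2n : 0 ≤ T2 := PrW_nonneg D₂ hp0 hp1 _
  have hsum1 : Z1 + B1 + A1 + M1 + T1 = 1 := cells_sum_eq_one p D₁ o u v
  have hsum2 : Z2 + B2 + A2 + M2 + T2 = 1 := cells_sum_eq_one p D₂ o u v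
  -- hypotheses in the cell format of file V
  have hHo1 : (T1 + B1) * (T1 + A1) ≤ T1 := by
    linarith [hH₁, show (T1 + B1) * (T1 + A1) = (B1 + T1) * (A1 + T1) by ring]
  have hHo2 : (T2 + B2) * (T2 + A2) ≤ T2 := by
    linarith [hH₂, show (T2 + B2) * (T2 + A2) = (B2 + T2) * (A2 + T2) by ring]
  have hHu1 : (T1 + B1) * (M1 + T1) ≤ T1 := by
    linarith [hU₁, show (T1 + B1) * (M1 + T1) = (B1 + T1) * (M1 + T1) by ring]
  have hHu2 : (T2 + B2) * (M2 + T2) ≤ T2 := by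
    linarith [hU₂, show (T2 + B2) * (M2 + T2) = (B2 + T2) * (M2 + T2) by ring]
  have hHv1 : (T1 + A1) * (M1 + T1) ≤ T1 := by
    linarith [hV₁, show (T1 + A1) * (M1 + T1) = (A1 + T1) * (M1 + T1) by ring]
  have hHv2 : (T2 + A2) * (M2 + T2) ≤ T2 := by
    linarith [hV₂, show (T2 + A2) * (M2 + T2) = (A2 + T2) * (M2 + T2) by ring]
  have hE1' : (T1 - (T1 + B1) * (T1 + A1)) ^ 2 ≤ 28 / 27 * ((T1 + B1) * (T1 + A1)) * M1 := by
    have e1 : (T1 - (T1 + B1) * (T1 + A1)) ^ 2 = (T1 - (B1 + T1) * (A1 + T1)) ^ 2 := by ring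
    have e2 : 28 / 27 * ((T1 + B1) * (T1 + A1)) * M1 = 28 / 27 * (B1 + T1) * (A1 + T1) * M1 := by ring
    rw [e1, e2]; exact hE₁
  have hE2' : (T2 - (T2 + B2) * (T2 + A2)) ^ 2 ≤ 28 / 27 * ((T2 + B2) * (T2 + A2)) * M2 := by
    have e1 : (T2 - (T2 + B2) * (T2 + A2)) ^ 2 = (T2 - (B2 + T2) * (A2 + T2)) ^ 2 := by ring
    have e2 : 28 / 27 * ((T2 + B2) * (T2 + A2)) * M2 = 28 / 27 * (B2 + T2) * (A2 + T2) * M2 := by ring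
    rw [e1, e2]; exact hE₂
  -- composite cells
  obtain ⟨zB, hzB⟩ : ∃ t : ℝ, t = Z1 * B2 + B1 * Z2 + B1 * B2 := ⟨_, rfl⟩
  obtain ⟨zA, hzA⟩ : ∃ t : ℝ, t = Z1 * A2 + A1 * Z2 + A1 * A2 := ⟨_, rfl⟩
  obtain ⟨zm, hzm⟩ : ∃ t : ℝ, t = Z1 * M2 + M1 * Z2 + M1 * M2 := ⟨_, rfl⟩
  obtain ⟨zτ, hzτ⟩ : ∃ t : ℝ, t = T1 * (Z2 + B2 + A2 + M2 + T2) + (Z1 + B1 + A1 + M1) * T2 + B1 * (A2 + M2) + A1 * (B2 + M2) + M1 * (B2 + A2) :=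
    ⟨_, rfl⟩
  have eτ : Z1 * T2 + B1 * A2 + B1 * M2 + B1 * T2 + A1 * B2 + A1 * M2 + A1 * T2 + M1 * B2 + M1 * A2 + M1 * T2 + T1 * Z2 + T1 * B2
      + T1 * A2 + T1 * M2 + T1 * T2 = zτ := by rw [hzτ]; ring
  have eB : Z1 * B2 + B1 * Z2 + B1 * B2 = zB := by rw [hzB]
  have eA : Z1 * A2 + A1 * Z2 + A1 * A2 = zA := by rw [hzA]
  have em : Z1 * M2 + M1 * Z2 + M1 * M2 = zm := by rw [hzm]
  rw [eτ, eB, eA, em]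
  have key : (zτ - (zτ + zB) * (zτ + zA)) ^ 2 ≤ 28 / 27 * ((zτ + zB) * (zτ + zA)) * zm := by
    rcases (add_nonneg hZ1n hM1n).eq_or_lt with hO1 | hO1
    · exact comp_le_of_apex_joined Z1 B1 A1 M1 T1 Z2 B2 A2 M2 T2 zB zA zm zτ hZ1n hB1n hA1n hM1n hT1n hsum1 hZ2n hB2n hA2n hM2n hT2n hsum2
        (Or.inl hO1.symm) hHo1 hHo2 hzB hzA hzm hzτ
    rcases (add_nonneg hZ2n hM2n).eq_or_lt with hO2 | hO2
    · exact comp_le_of_apex_joined Z1 B1 A1 M1 T1 Z2 B2 A2 M2 T2 zB zA zm zτ hZ1n hB1n hA1n hM1n hT1n hsum1 hZ2n hB2n hA2n hM2n hT2n hsum2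
        (Or.inr hO2.symm) hHo1 hHo2 hzB hzA hzm hzτ
    exact twoSided_comp_le Z1 B1 A1 M1 T1 Z2 B2 A2 M2 T2 zB zA zm zτ hZ1n hB1n hA1n hM1n hT1n hsum1 hZ2n hB2n hA2n hM2n hT2n hsum2
      hO1 hO2 hHo1 hHu1 hHv1 hHo2 hHu2 hHv2 hE1' hE2' hzB hzA hzm hzτ
  have e1 : (zτ - (zB + zτ) * (zA + zτ)) ^ 2 = (zτ - (zτ + zB) * (zτ + zA)) ^ 2 := by ring
  have e2 : 28 / 27 * (zB + zτ) * (zA + zτ) * zm = 28 / 27 * ((zτ + zB) * (zτ + zA)) * zm := by ring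
  rw [e1, e2]; exact key

end Parallel

/-! ### §2 The series–parallel theorem: `E ≤ 28/27` on every two-terminal series–parallel apex network (classical instances only,
matching the `Finset` operations inside `GZSP.IsSPNet`) -/

section SeriesParallel

/-- **Port swap**: the division-free inequality `κ² ≤ C·pπ·m` for `(o; u, v)` is the same statement as for `(o; v, u)`. [folklore] -/
theorem E_swap (p : Sym2 V → ℝ) (D : Finset (Sym2 V)) (o u v : V) (C : ℝ)
    (hE : (PrW D p {K : Finset (Sym2 V) | u ∈ cl K o ∧ v ∈ cl K o}
        - PrW D p {K : Finset (Sym2 V) | u ∈ cl K o} * PrW D p {K : Finset (Sym2 V) | v ∈ cl K o}) ^ 2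
        ≤ C * PrW D p {K : Finset (Sym2 V) | u ∈ cl K o} * PrW D p {K : Finset (Sym2 V) | v ∈ cl K o}
          * PrW D p {K : Finset (Sym2 V) | u ∉ cl K o ∧ v ∈ cl K u}) :
    (PrW D p {K : Finset (Sym2 V) | v ∈ cl K o ∧ u ∈ cl K o}
        - PrW D p {K : Finset (Sym2 V) | v ∈ cl K o} * PrW D p {K : Finset (Sym2 V) | u ∈ cl K o}) ^ 2
      ≤ C * PrW D p {K : Finset (Sym2 V) | v ∈ cl K o} * PrW D p {K : Finset (Sym2 V) | u ∈ cl K o}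
        * PrW D p {K : Finset (Sym2 V) | v ∉ cl K o ∧ u ∈ cl K v} := by
  have hτ : PrW D p {K : Finset (Sym2 V) | v ∈ cl K o ∧ u ∈ cl K o} = PrW D p {K : Finset (Sym2 V) | u ∈ cl K o ∧ v ∈ cl K o} :=
    PrW_congr_set D p fun K _ => by simp only [Set.mem_setOf_eq]; exact And.comm
  rw [hτ, m_event_comm p D o u v]
  convert hE using 1 <;> ring

/-- **An isolated first port** (`u` in no edge of `D`, `u ≠ o`): `p = τ = 0`, so `κ² ≤ C·pπ·m` trivially. [folklore] -/
theorem portIsolated_left_E (p : Sym2 V → ℝ) (D : Finset (Sym2 V)) {o u v : V} (hD : ∀ e ∈ D, u ∉ e) (huo : u ≠ o) (C : ℝ) :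
    (PrW D p {K : Finset (Sym2 V) | u ∈ cl K o ∧ v ∈ cl K o}
        - PrW D p {K : Finset (Sym2 V) | u ∈ cl K o} * PrW D p {K : Finset (Sym2 V) | v ∈ cl K o}) ^ 2
      ≤ C * PrW D p {K : Finset (Sym2 V) | u ∈ cl K o} * PrW D p {K : Finset (Sym2 V) | v ∈ cl K o}
        * PrW D p {K : Finset (Sym2 V) | u ∉ cl K o ∧ v ∈ cl K u} := by
  have hp : PrW D p {K : Finset (Sym2 V) | u ∈ cl K o} = 0 :=
    PrW_eq_zero_of_forall_not_mem D p fun L hL hmem =>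
      pendant_not_mem_cl (fun f hf => hD f (hL hf)) huo.symm (mem_cl_comm.1 hmem)
  have hτ : PrW D p {K : Finset (Sym2 V) | u ∈ cl K o ∧ v ∈ cl K o} = 0 :=
    PrW_eq_zero_of_forall_not_mem D p fun L hL hmem =>
      pendant_not_mem_cl (fun f hf => hD f (hL hf)) huo.symm (mem_cl_comm.1 hmem.1)
  rw [hτ, hp]; simp

/-- **An isolated second port** (`v` in no edge of `D`, `v ≠ o`): `π = τ = 0`, so `κ² ≤ C·pπ·m` trivially. [folklore] -/
theorem portIsolated_right_E (p : Sym2 V → ℝ) (D : Finset (Sym2 V)) {o u v : V} (hD : ∀ e ∈ D, v ∉ e) (hvo : v ≠ o) (C : ℝ) :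
    (PrW D p {K : Finset (Sym2 V) | u ∈ cl K o ∧ v ∈ cl K o}
        - PrW D p {K : Finset (Sym2 V) | u ∈ cl K o} * PrW D p {K : Finset (Sym2 V) | v ∈ cl K o}) ^ 2
      ≤ C * PrW D p {K : Finset (Sym2 V) | u ∈ cl K o} * PrW D p {K : Finset (Sym2 V) | v ∈ cl K o}
        * PrW D p {K : Finset (Sym2 V) | u ∉ cl K o ∧ v ∈ cl K u} := by
  have hπ : PrW D p {K : Finset (Sym2 V) | v ∈ cl K o} = 0 :=
    PrW_eq_zero_of_forall_not_mem D p fun L hL hmem =>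
      pendant_not_mem_cl (fun f hf => hD f (hL hf)) hvo.symm (mem_cl_comm.1 hmem)
  have hτ : PrW D p {K : Finset (Sym2 V) | u ∈ cl K o ∧ v ∈ cl K o} = 0 :=
    PrW_eq_zero_of_forall_not_mem D p fun L hL hmem =>
      pendant_not_mem_cl (fun f hf => hD f (hL hf)) hvo.symm (mem_cl_comm.1 hmem.2)
  rw [hτ, hπ]; simp

/-- **THE SERIES–PARALLEL THEOREM (`PrW` form).**  For every two-terminal series–parallel apex network `GZSP.IsSPNet o E u v` (single edges
`s(u,v)`, apex edges attached at terminals, series and parallel composition: the `u–v` network avoiding `o` is an arbitrary two-terminal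
series–parallel graph and the apex `o` is joined to ANY set of its vertices) and arbitrary weights in `[0,1]`:
`(P(u,v ∈ cl o) − P(u ∈ cl o)·P(v ∈ cl o))² ≤ (28/27)·P(u ∈ cl o)·P(v ∈ cl o)·P(u ∉ cl o, v ∈ cl u)`, i.e. `E = κ²/(pπm) ≤ 28/27`.
Induction over the syntax: `apexFree_E`; apex edges by `parallel_comp_le` with the one-edge pieces `portIsolated_right_E` / `portIsolated_left_E`;
series steps by `series_reduction` + `E_swap`; parallel steps by `parallel_comp_le`.  Optimal (balanced apex ladders, `…APLLadderSharpness`);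
`E > 28/27` occurs outside the class (memo gen 56: `1.1158`). [this work] -/
theorem sp_E_le (p : Sym2 V → ℝ) (hp0 : ∀ e, 0 ≤ p e) (hp1 : ∀ e, p e ≤ 1) {o : V} {E : Finset (Sym2 V)} {u v : V}
    (h : GZSP.IsSPNet o E u v) :
    (PrW E p {K : Finset (Sym2 V) | u ∈ cl K o ∧ v ∈ cl K o}
        - PrW E p {K : Finset (Sym2 V) | u ∈ cl K o} * PrW E p {K : Finset (Sym2 V) | v ∈ cl K o}) ^ 2
      ≤ 28 / 27 * PrW E p {K : Finset (Sym2 V) | u ∈ cl K o} * PrW E p {K : Finset (Sym2 V) | v ∈ cl K o}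
        * PrW E p {K : Finset (Sym2 V) | u ∉ cl K o ∧ v ∈ cl K u} := by
  induction h with
  | @edge a b hab hac hbc =>
    exact apexFree_E p {s(a, b)} (fun e he => by
      rw [Finset.mem_singleton] at he
      subst he
      intro ho
      rcases Sym2.mem_iff.1 ho with h | h
      · exact hac h.symm
      · exact hbc h.symm) hac (28 / 27)
  | @hubLeft E a b h he ih =>
    obtain ⟨hab, -, hbo⟩ := h.terminals_ne
    rw [Finset.insert_eq]
    refine parallel_comp_le p hp0 hp1 {s(a, o)} E (Finset.disjoint_singleton_left.2 he) o a b ?_ ?_ ih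
    · rintro x ⟨e, he', hxe⟩ _
      rw [Finset.mem_singleton] at he'
      subst he'
      rcases Sym2.mem_iff.1 hxe with rfl | rfl
      · exact Or.inr (Or.inl rfl)
      · exact Or.inl rfl
    · exact portIsolated_right_E p {s(a, o)} (fun e he' hbe => by
        rw [Finset.mem_singleton] at he'
        subst he'
        rcases Sym2.mem_iff.1 hbe with h | h
        · exact hab h.symm
        · exact hbo h) hbo (28 / 27)
  | @hubRight E a b h he ih =>
    obtain ⟨hab, hao, -⟩ := h.terminals_ne
    rw [Finset.insert_eq]
    refine parallel_comp_le p hp0 hp1 {s(b, o)} E (Finset.disjoint_singleton_left.2 he) o a b ?_ ?_ ih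
    · rintro x ⟨e, he', hxe⟩ _
      rw [Finset.mem_singleton] at he'
      subst he'
      rcases Sym2.mem_iff.1 hxe with rfl | rfl
      · exact Or.inr (Or.inr rfl)
      · exact Or.inl rfl
    · exact portIsolated_left_E p {s(b, o)} (fun e he' hae => by
        rw [Finset.mem_singleton] at he'
        subst he'
        rcases Sym2.mem_iff.1 hae with h | h
        · exact hab h
        · exact hao h) hao (28 / 27)
  | @series E₁ E₂ a m b h₁ h₂ hd hS ha hb ih₁ ih₂ =>
    have hao : a ≠ o := h₁.terminals_ne.2.1
    have hbo : b ≠ o := h₂.terminals_ne.2.2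
    obtain ⟨-, ⟨f, hf, hbf⟩⟩ := h₂.terminals_mem
    have hab : a ≠ b := fun heq => ha f hf (by rw [heq]; exact hbf)
    exact series_reduction p hp0 hp1 E₁ E₂ hd o m a b (fun x h1 h2 => (hS x h1 h2).symm)
      (fun e he hae => absurd hae (ha e he)) (fun e he hbe => absurd hbe (hb e he)) hao hbo hab (28 / 27) (by norm_num)
      ih₁ (E_swap p E₂ o m b (28 / 27) ih₂)
  | @parallel E₁ E₂ a b h₁ h₂ hd hS ih₁ ih₂ =>
    exact parallel_comp_le p hp0 hp1 E₁ E₂ hd o a b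
      (fun x h1 h2 => by
        rcases hS x h1 h2 with h | h | h
        exacts [Or.inr (Or.inl h), Or.inr (Or.inr h), Or.inl h]) ih₁ ih₂

end SeriesParallel


/-- **THE SERIES–PARALLEL THEOREM for bond percolation** (`μ = prodBernoulli w` on the pairs of a finite vertex type).  If every pair of
positive weight lies in a two-terminal series–parallel apex network `E` with ports `u, v` and apex `o` (`GZSP.IsSPNet o E u v`: the `u–v`
graph avoiding `o` is two-terminal series–parallel, the apex `o` joined to any of its vertices, arbitrary weights), then
`(μ(o↔u ∩ o↔v) − μ(o↔u)·μ(o↔v))² ≤ (28/27)·μ(o↔u)·μ(o↔v)·μ((o↔u)ᶜ ∩ u↔v)`, i.e. `E = κ²/(pπ·m) ≤ 28/27`; the lineage's Conjecture (★★₂)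
asks `E ≤ 2` for every finite graph. [this work] -/
theorem sp_E_le_prodBernoulli (w : Sym2 V → unitInterval) {o : V} {E : Finset (Sym2 V)} {u v : V} (h : GZSP.IsSPNet o E u v)
    (hw : ∀ e : Sym2 V, 0 < (w e : ℝ) → e ∈ E) :
    ((Literature.Probability.LatticeModels.prodBernoulli w).real
          ((openConn o u : Set (BondConfig V)) ∩ (openConn o v : Set (BondConfig V)))
        - (Literature.Probability.LatticeModels.prodBernoulli w).real (openConn o u : Set (BondConfig V))
          * (Literature.Probability.LatticeModels.prodBernoulli w).real (openConn o v : Set (BondConfig V))) ^ 2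
      ≤ 28 / 27 * (Literature.Probability.LatticeModels.prodBernoulli w).real (openConn o u : Set (BondConfig V))
        * (Literature.Probability.LatticeModels.prodBernoulli w).real (openConn o v : Set (BondConfig V))
        * (Literature.Probability.LatticeModels.prodBernoulli w).real
          ((openConn o u : Set (BondConfig V))ᶜ ∩ (openConn u v : Set (BondConfig V))) := by
  have hcl : ∀ (T : Finset (Sym2 V)) (a b : V), (↑T : Set (Sym2 V)) ∈ openConn a b ↔ b ∈ cl T a :=
    fun T a b => by rw [mem_cl]; rfl
  have hp0 : ∀ e, 0 ≤ (fun e => (w e : ℝ)) e := fun e => (w e).2.1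
  have hp1 : ∀ e, (fun e => (w e : ℝ)) e ≤ 1 := fun e => (w e).2.2
  have hsupp : ∀ X : Set (Finset (Sym2 V)), PrW Finset.univ (fun e => (w e : ℝ)) X = PrW E (fun e => (w e : ℝ)) X :=
    fun X => PrW_of_support (fun e => (w e : ℝ)) (Finset.subset_univ E) (fun e _ heE => by
      by_contra hne
      exact heE (hw e (lt_of_le_of_ne (w e).2.1 (Ne.symm hne)))) X
  have cτ : (Literature.Probability.LatticeModels.prodBernoulli w).real
      ((openConn o u : Set (BondConfig V)) ∩ (openConn o v : Set (BondConfig V)))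
      = PrW E (fun e => (w e : ℝ)) {K : Finset (Sym2 V) | u ∈ cl K o ∧ v ∈ cl K o} := by
    rw [prodBernoulli_real_eq_PrW_univ w (X := {K : Finset (Sym2 V) | u ∈ cl K o ∧ v ∈ cl K o}) fun T => by
      simp only [Set.mem_setOf_eq, Set.mem_inter_iff, hcl], hsupp]
  have cp : (Literature.Probability.LatticeModels.prodBernoulli w).real (openConn o u : Set (BondConfig V))
      = PrW E (fun e => (w e : ℝ)) {K : Finset (Sym2 V) | u ∈ cl K o} := by
    rw [prodBernoulli_real_eq_PrW_univ w (X := {K : Finset (Sym2 V) | u ∈ cl K o}) fun T => by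
      simp only [Set.mem_setOf_eq, hcl], hsupp]
  have cπ : (Literature.Probability.LatticeModels.prodBernoulli w).real (openConn o v : Set (BondConfig V))
      = PrW E (fun e => (w e : ℝ)) {K : Finset (Sym2 V) | v ∈ cl K o} := by
    rw [prodBernoulli_real_eq_PrW_univ w (X := {K : Finset (Sym2 V) | v ∈ cl K o}) fun T => by
      simp only [Set.mem_setOf_eq, hcl], hsupp]
  have cm : (Literature.Probability.LatticeModels.prodBernoulli w).real
      ((openConn o u : Set (BondConfig V))ᶜ ∩ (openConn u v : Set (BondConfig V)))
      = PrW E (fun e => (w e : ℝ)) {K : Finset (Sym2 V) | u ∉ cl K o ∧ v ∈ cl K u} := by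
    rw [prodBernoulli_real_eq_PrW_univ w (X := {K : Finset (Sym2 V) | u ∉ cl K o ∧ v ∈ cl K u}) fun T => by
      simp only [Set.mem_setOf_eq, Set.mem_inter_iff, Set.mem_compl_iff, hcl], hsupp]
  rw [cτ, cp, cπ, cm]
  exact sp_E_le (fun e => (w e : ℝ)) hp0 hp1 h

end APL

end Summit.CriticalPhenomena.PercolationContinuityZ3.Theorems
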